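import Mathlib
import Summits.Langlands.Langlands.Theses.EvenVoidBelowEight
import Literature.NumberTheory.Automorphic.TaylorComplexConjugationOddRank
import Literature.NumberTheory.GaloisRepresentations.CalegariEvenFontaineMazurTwo
import Literature.NumberTheory.GaloisRepresentations.ExtendedAdequateSubgroup
import Literature.NumberTheory.GaloisRepresentations.AbsGaloisGroup
import HarnessLib

/-!
# BC3 birth skeleton — crux `ThreeAdicAdequateImages` (item stmt-Langlands-17643) of route `EvenVoidBelowEight`

Skeleton registrar `planner-skel-stmt-Langlands-17643-0`, 2026-08-17 (route re-audit bin HONEST).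
Published as `Cruxes/ThreeAdicAdequateImages/Lines/birth.lean`.

The crux (rank 3, "C2" of the route): at `p = 3` there is no continuous EVEN
`ρ : Γ_ℚ → GL₂(ℚ̄₃)`, unramified almost everywhere, de Rham at `3` (pinned Fontaine datum) with
multiplicity-free labelled Hodge–Tate weights, residually absolutely irreducible and not of dihedral
type, whose projective residual image has order `∉ {12, 360}` (i.e. is neither `A₄ ≅ PSL₂(𝔽₃)` nor
`A₆ ≅ PSL₂(𝔽₉)`, the two Guralnick–Herzig–Tiep exceptions, which form the sibling crux C1).  The line
is the route's own: Calegari II (arXiv:1012.4819 §§3–4) re-run in degree `d = p = 3` — a Hilbert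
modular shadow `h`, the nine-dimensional `ϱ = Sym² ρ ⊗ Sym² ρ_h`, automorphy of `ϱ` over a CM field by
a Taylor–Wiles–Kisin lifting theorem in Thorne's extended-adequate setting (`3 ∣ 9`), descent to the
totally real subfield, and `tr ϱ(c) = +3` against Taylor's sign theorem (`|tr r(c)| ≤ 1`, `n` odd).

Stubs (5, each a genuine lemma of the line; statements over existing declarations only):
* `stub_evenCyclotomicRestriction` — EVENNESS MAKES THE `ζ₃`-RESTRICTION HARMLESS: for an even
  `ρ : Γ_ℚ → GL₂(ℚ̄₃)` the projective image of `ρ̄` does not shrink on `Γ_{ℚ(ζ₃)}` (`ρ(c) = ±1`, so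
  `ρ̄(c)` is scalar, while `c ∉ Γ_{ℚ(ζ₃)} = ker ε̄₃`, a subgroup of index `≤ 2`).  Specific to `p = 3`
  (`ℚ(ζ₃)` is imaginary quadratic); it is what lets the crux be cut by the FULL projective image
  (orders `12`, `360`) although adequacy is needed on `Γ_{ℚ(ζ₃)}` (size M);
* `stub_symSqCyclotomicAdequate` — GROUP THEORY AT `p = 3`: for `ρ̄` absolutely irreducible, not
  dihedral, with projective image of `ρ̄|Γ_{ℚ(ζ₃)}` of order `∉ {12, 360}`, the image of
  `Sym² ρ̄|Γ_{ℚ(ζ₃)}` in `GL₃(𝔽̄₃)` is adequate in the extended sense (`Subgroup.IsExtendedAdequate`) —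
  Guralnick–Herzig–Tiep 2017 Thm. 1.7 (`dim V = p`: adequate unless an abelian normal subgroup of
  index `p`, or `(3, PSL₂(9))`; tree fact `ght2017_adequate_or_index_p_or_psl29`, the `S₄` case PROVED
  in `AdequacyDegreeP`) plus the elementary exclusion of the two alternatives (size L);
* `stub_cmNinefoldShadow` — THE ENGINE (Calegari II Props. 3.4–3.10, 4.1 and the lifting theorem, at
  `l = 3`): from the crux data and the adequacy of `Sym² ρ̄(Γ_{ℚ(ζ₃)})`, a totally real `F`, a CM
  quadratic `E/F`, an odd `n` and `r : Γ_F → GL_n(ℚ̄₃)` (Calegari: `n = 9`,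
  `r = (Sym² ρ ⊗ Sym² ρ_h)|Γ_F`), irreducible on `Γ_F` and on `Γ_E`, with `r|Γ_E` HLTT-compatible with
  a regular algebraic cuspidal `Π` of `GL_n(𝔸_E)`, and a complex conjugation `c ∈ Γ_F` with
  `tr r(c) ∉ {1, −1}` (Calegari: `= +3`) (size XL — every printed automorphic input is stated for
  `l ≥ 2(d+1)` or `l ∤ n`);
* `stub_quadraticDescent` — Arthur–Clozel descent along the CM quadratic extension `E/F` for Galois
  representations: `r : Γ_F → GL_n(ℚ̄₃)` with `r|Γ_E` irreducible and automorphic (regular algebraic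
  cuspidal) is automorphic over `F` (size L; [AC] Thm. III.4.2 + strong multiplicity one + HLTT);
* `stub_signOddRank` — Taylor 2012 Prop. 1 / Caraiani–Le Hung 2016 Thm. 1.1 at `l = 3`: `tr r(c) = ±1`
  for `r ≅ r_{3,ι}(π)` irreducible, `π` regular algebraic cuspidal on `GL_n`, `n` odd, `F` totally real
  (citation-grade: the tree's `Taylor2012_prop1_of_caraianiLeHung2016` under the named fact
  `CaraianiLeHung2016_thm_1_1`).

`ThreeAdicAdequateImages_of (h₁ … h₅) : ThreeAdicAdequateImages` is KERNEL-CHECKED below (no sorry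
outside `stub_*`; each `_Goal.stub_k : Prop := type_of% @stub_k` is the stub's statement BY NAME, the
registrar's convention): stub 1 turns the crux's full-image clause into the restricted-image clause,
stub 2 gives adequacy, stub 3 the automorphic shadow over `E`, stub 4 descends it to `F`, stub 5 forces
`tr r(c) = ±1`, contradiction.

Honesty notes. (i) No stub is the crux or the summit reworded: stubs 1–2 are statements about the
residual representation only (no `p`-adic Hodge theory, no evenness in stub 2), stub 3 concludes the
existence of automorphic data (not `False`), stubs 4–5 are theorems about automorphic Galois
representations with no `ρ` in them; the BC3 probes `stub → ThreeAdicAdequateImages` and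
`stub → Langlands` by `exact? | simpa | aesop` fail for all five (seat folder `bc/probes/`).  (ii) Every
intermediate statement of a voidness proof is implied by the voidness; in particular stub 3 is, given
stubs 4–5, as strong as the crux on its cell — it is the crux's mass, NAMED and typed by its output, not
hidden.  (iii) Disproof.lean / Negative lemmas for this crux: none exist (`ledger crux ls
stmt-Langlands-17643`: no workfiles before this one); `ledger negatives --problem Langlands` (4 entries:
SplitPrimeInduction ×2, OrdinaryPrimeTransport `n = 0` junk, K3KugaSatakeDescent) are unrelated — the
`n = 0` junk of stmt-Langlands-17212 cannot bite stubs 3–5 (`Odd n`, resp. irreducibility of a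
rank-`n` representation, fail at `n = 0`).  (iv) The crux as typed carries no `(h : Fact)` antecedents,
so stubs 2, 4, 5 (published theorems) are stated as theorems to be proved/vendored, exactly as the sign
fact `CaraianiLeHung2016_thm_1_1` and the adequacy fact `ght2017_adequate_or_index_p_or_psl29` already
are.

References: F. Calegari, J. Amer. Math. Soc. 25 (2012) = arXiv:1012.4819, Thm. 1.1–1.2, Props. 3.4–3.10,
Prop. 4.1, §4, §6 [Calegari2011]; R. Guralnick, F. Herzig, P. Tiep, JEMS 19 (2017) = arXiv:1405.0043,
Thm. 1.7, Cor. 9.4–9.5 [GuralnickHerzigTiep2017]; T. Barnet-Lamb, T. Gee, D. Geraghty, R. Taylor, Ann. of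
Math. 179 (2014) = arXiv:1010.2561, Prop. 3.3.1, Thm. 4.2.1, Thm. 4.5.1, Thm. A [BarnetlambEtAl2014];
J. Thorne, J. Inst. Math. Jussieu 11 (2012) and Math. Z. 285 (2017) Def. 2.20 [Thorne2017TwoAdic];
S.-N. Tung, ANT 15 (2021) = arXiv:1803.07451 [Tung2021]; J. Arthur, L. Clozel, Ann. of Math. Stud. 120
(1989), Thm. III.4.2 [ArthurClozel1989]; R. Taylor, ANT 6 (2012) 405–435, Prop. 1 [Taylor2012];
A. Caraiani, B. Le Hung, Compositio 152 (2016), Thm. 1.1 [CaraianiLehung2016].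
-/

noncomputable section

set_option linter.dupNamespace false

open scoped NumberField MatrixGroups
open IsDedekindDomain Field NumberField
open Literature.NumberTheory.GaloisRepresentations Literature.NumberTheory.PAdicHodge
open Literature.NumberTheory.Automorphic

namespace Summit.Langlands.Langlands.Cruxes.ThreeAdicAdequateImages.Birth

/-- **stub 1 — evenness makes the restriction to `Γ_{ℚ(ζ₃)}` harmless.**  For an EVEN
`ρ : Γ_ℚ → GL₂(ℚ̄₃)` the projective image of the residual representation `ρ̄ = ρ.residualRep`
restricted to `Γ_{ℚ(ζ₃)} = ker ε̄₃` (`(modPCyclotomicCharacterZMod ℚ 3).ker`) is the WHOLE projective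
image of `ρ̄` (equality of subgroups of `PGL₂(ℤ̄₃/𝔪)`).  Proof sketch: in rank `2` with `2 ≠ 0`, even
means `ρ(c) = ±1` for every complex conjugation `c` (`FramedGaloisRep.isEven_iff_eq_one_or_eq_neg_one`,
`exists_isComplexConjugation (Rat.castHom ℝ)`); `ρ̄` is a semisimplified reduction (`residualRep_spec`,
rank-`2` existence `exists_semisimplification_fin_two`), so `ρ̄(c)` is semisimple with characteristic
polynomial `(X ∓ 1)²`, i.e. `ρ̄(c) = ±1` is scalar and `c` dies in the projective image; but `c` inverts
`ζ₃` (`IsComplexConjugation`: `ι(c • x) = conj (ι x)`), so `ε̄₃(c) = −1 ≠ 1`, `c ∉ Γ_{ℚ(ζ₃)}`, and as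
`(ℤ/3)ˣ` has order `2`, `Γ_ℚ = Γ_{ℚ(ζ₃)} ⊔ c·Γ_{ℚ(ζ₃)}`; hence both cosets have the same projective image.
Why it matters: adequacy (stub 2) is a condition on `Γ_{ℚ(ζ₃)}`, where an ODD-type `ρ̄` with projective
image `S₄` or `PGL₂(𝔽₉)` may drop to the inadequate `A₄` / `PSL₂(𝔽₉)` when the sign field is `ℚ(√−3)`;
for even `ρ` it cannot (the projective splitting field is totally real), which is why the crux may be —
and is — cut by the orders `12`, `360` of the FULL projective image.  Specific to `p = 3` (`ℚ(ζ_p)` has a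
real subfield for `p ≥ 5`: compare the `S₅`/`ℚ(√5)` cell of the sibling crux at `p = 5`).  Size M
(formal: reduction bookkeeping for `residualRep`, the action of `c` on `μ₃`).
[cite: Calegari2011, §4 ("`ρ(c_v)` is a scalar")] [cite: GuralnickHerzigTiep2017, Thm. 1.7] -/
theorem stub_evenCyclotomicRestriction :
    ∀ (ρ : FramedGaloisRep ℚ (PadicAlgCl 3) 2), ρ.IsEven →
      projectiveImage (ρ.residualRep.comp (modPCyclotomicCharacterZMod ℚ 3).ker.subtype) =
        projectiveImage ρ.residualRep := by
  sorry

/-- **stub 2 — adequacy of `Sym² ρ̄(Γ_{ℚ(ζ₃)})` in the extended sense (group theory at `p = 3`).**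
For `ρ : Γ_ℚ → GL₂(ℚ̄₃)` residually absolutely irreducible with `ρ̄` not of dihedral type, if the
projective image of `ρ̄|Γ_{ℚ(ζ₃)}` has order neither `12` nor `360`, then the image of
`Sym² ρ̄|Γ_{ℚ(ζ₃)} : Γ_{ℚ(ζ₃)} → GL₃(ℤ̄₃/𝔪)` (`Matrix.GeneralLinearGroup.symSq`, the rendering of
`Calegari2011_thm_1_2`) is adequate in the extended sense of Guralnick–Herzig–Tiep §1 / Thorne 2017
Def. 2.20 (`Subgroup.IsExtendedAdequate`: `H¹(H,k) = 0`, `H¹(H, ad/Z) = 0`, `End` spanned by semisimple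
elements — the notion allowing `p ∣ dim`).  Proof sketch: `ρ̄|Γ_{ℚ(ζ₃)}` is still absolutely irreducible
and non-dihedral (an index-`≤ 2` restriction of a non-dihedral irreducible `ρ̄` is reducible only if
`ρ̄` is induced from `ℚ(ζ₃)`, and its projective image is the full one or its unique index-two subgroup,
`A₄ < S₄` being excluded by the order hypothesis); hence `Sym²` is absolutely irreducible of dimension
`3 = p` (an invariant line/plane in `Sym² V` is a quadratic form, forcing a torus normaliser or a
line); GHT 2017 Thm. 1.7 (tree fact `ght2017_adequate_or_index_p_or_psl29`, `CharP (ℤ̄₃/𝔪) 3` by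
`charP_padicAlgClResidueField`) leaves: adequate, OR an abelian normal subgroup of index `3` — whose
image in the projective group `H` (orders: `S₄` none of index `3`; `A₅`, `PSL₂(3^a)` simple;
`PGL₂(3^a) ▷ PSL₂(3^a)` only; in general an abelian normal `Ā ⊴ H` of index `3` makes `H` cyclic,
dihedral or `A₄`) is excluded by irreducibility, non-dihedrality and `|H| ≠ 12`, OR `(3, PSL₂(9) ≅ A₆)`,
excluded by `|H| ≠ 360` (`nonempty_projectiveImage_mulEquiv_quotient`).  The `S₄ = PGL₂(𝔽₃)` cell is
PROVED in the tree (`isExtendedAdequate_range_of_isAbsIrreducible_perm_fin4`; the planner's 9/9 span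
computation), the `A₆` exclusion is sharp (`AdequacyDegreeThreeException`).  Why it might fail: only
through the bookkeeping `image of Sym² ↔ projective image` (scalars `λ ↦ λ²`) and finiteness of the
residual image; the cells `A₅ < PGL₂(𝔽₉)`, `PGL₂(𝔽₉)`, `P(S/G)L₂(𝔽₂₇)` are exactly the route's
CHEAPEST FALSIFIER (MeatAxe audit), all predicted adequate by Thm. 1.7.  Size L (conditional on the
GHT fact: M).
[cite: GuralnickHerzigTiep2017, Thm. 1.7, Cor. 9.4–9.5] [cite: Thorne2017TwoAdic, Def. 2.20] [cite: Calegari2011, §6] -/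
theorem stub_symSqCyclotomicAdequate :
    ∀ (ρ : FramedGaloisRep ℚ (PadicAlgCl 3) 2), ρ.IsResiduallyAbsIrreducible →
      ¬ IsDihedralType ρ.residualRep →
      ¬ (Nat.card (projectiveImage (ρ.residualRep.comp (modPCyclotomicCharacterZMod ℚ 3).ker.subtype)) = 12 ∨
          Nat.card (projectiveImage (ρ.residualRep.comp (modPCyclotomicCharacterZMod ℚ 3).ker.subtype)) = 360) →
      Literature.NumberTheory.GaloisRepresentations.Subgroup.IsExtendedAdequate
        ((Matrix.GeneralLinearGroup.symSq.comp ρ.residualRep).comp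
          (modPCyclotomicCharacterZMod ℚ 3).ker.subtype).range := by
  sorry

/-- **stub 3 — the engine: Calegari's nine-dimensional shadow is automorphic over a CM field, with the
even sign (Calegari II Props. 3.4, 3.5, 3.7, 3.9, 3.10, 4.1 and the lifting theorem of §4–5, re-run at
`l = 3`).**  For `ρ : Γ_ℚ → GL₂(ℚ̄₃)` even, unramified a.e., de Rham at `3` with multiplicity-free
labelled Hodge–Tate weights (pinned datum), residually absolutely irreducible, non-dihedral, and with
`Sym² ρ̄(Γ_{ℚ(ζ₃)})` adequate in the extended sense (stub 2's conclusion, consumed verbatim), there are: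
a totally real number field `F`, a totally complex quadratic extension `E/F` (a CM field), an ODD `n`,
a continuous `r : Γ_F → GL_n(ℚ̄₃)` irreducible on `Γ_F` and on `Γ_E`, an `ι : ℚ̄₃ ≃ ℂ` and a regular
algebraic cuspidal `Π` of `GL_n(𝔸_E)` with `r|Γ_E` HLTT-compatible with `Π` (`r|Γ_E ≅ r_{3,ι}(Π)`), and a
complex conjugation `c ∈ Γ_F` (for a real embedding `φ` of `F`) with `tr r(c) ≠ 1` and `tr r(c) ≠ −1`.
Calegari's instance: `F = E⁺ = F₇⁺`, `n = 9`, `r = (Sym² ρ|Γ_F) ⊗ Sym² ρ_h` for the second Hilbert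
modular shadow `h` (ordinary crystalline of Hodge type `w`, `ρ̄_h` with image `⊇ SL₂(𝔽_{3^a})`,
`ρ_h|D_v ∼ ρ|D_v` for `v ∤ 3`), `Π` on `GL₉(𝔸_E)` from: Moret-Bailly/Snowden residual realisation
(Props. 3.4–3.5), component realisation of `ρ|D_3` by a Hilbert modular `g` (Prop. 3.7 — at `p = 3` by
Tung 2021, "every potentially semistable component is automorphic", replacing Kisin), an ordinary
RACSDC lift `π` of `Sym² ρ̄` over a CM field (Prop. 3.9, BLGGT Prop. 3.3.1 — printed for `l ≥ 2(3+1)`),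
potential automorphy of `Sym² ρ_g ⊗ ρ_π` (Prop. 4.1, BLGGT Thm. A), adequacy of the `9`-dimensional
`ϱ̄ = Sym² ρ̄ ⊗ Sym² ρ̄_h` on `Γ_{E(ζ₃)}` (from stub 2's input by Goursat + inflation–restriction, in the
EXTENDED sense since `3 ∣ 9`), and an automorphy lifting theorem with `l ∣ n` allowed (Thorne); then
`ρ(c) = ±1` (even, rank `2`) gives `Sym² ρ(c) = 1`, `tr Sym² ρ_h(c) = 1` (`ρ_h` odd), `tr r(c) = 3·1 = 3`.
Why it might fail: none of these automorphic inputs is in print at `l = 3` (`l ≥ 8`, `l > 5`,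
`l ∤ n` clauses throughout; `ζ₃ ∈ E(ζ₃)` cheaply), and the statement is — given stubs 4–5 — as strong
as the crux on its cell (every intermediate statement of a voidness proof is); it is the crux's mass,
named by its OUTPUT so that any functorial shadow with the even sign signature discharges it.  Size XL.
[cite: Calegari2011, Props. 3.4–3.10, Prop. 4.1, §4, §6] [cite: BarnetlambEtAl2014, Prop. 3.3.1, Thm. 4.2.1, Thm. 4.5.1, Thm. A] [cite: Tung2021, Thm. 1 and Cor. 4.4] [cite: GuralnickHerzigTiep2017, Cor. 9.4–9.5] -/
theorem stub_cmNinefoldShadow :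
    ∀ (ρ : FramedGaloisRep ℚ (PadicAlgCl 3) 2), ρ.IsEven →
      (∀ᶠ v : HeightOneSpectrum (𝓞 ℚ) in Filter.cofinite, ρ.IsUnramifiedAt v) →
      (∀ (v : HeightOneSpectrum (𝓞 ℚ)) (hv : ((3 : ℕ) : 𝓞 ℚ) ∈ v.asIdeal),
        (fontainePstAdicCompletion v 3 hv).IsDeRhamFramed (ρ.toLocal v) ∧
          ∀ τ : v.adicCompletion ℚ →+* PadicAlgCl 3, Continuous τ →
            (ρ.labelledHodgeTateWeightsAt v (fontainePstAdicCompletion v 3 hv).algebra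
              (fontainePstAdicCompletion v 3 hv).𝔅 τ).Nodup) →
      ρ.IsResiduallyAbsIrreducible → ¬ IsDihedralType ρ.residualRep →
      Literature.NumberTheory.GaloisRepresentations.Subgroup.IsExtendedAdequate
        ((Matrix.GeneralLinearGroup.symSq.comp ρ.residualRep).comp
          (modPCyclotomicCharacterZMod ℚ 3).ker.subtype).range →
      ∃ (F : Type) (_ : Field F) (_ : NumberField F), IsTotallyReal F ∧
        ∃ (E : Type) (_ : Field E) (_ : NumberField E) (_ : Algebra F E),
          Algebra.IsQuadraticExtension F E ∧ IsTotallyComplex E ∧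
        ∃ (n : ℕ), Odd n ∧
        ∃ (r : FramedGaloisRep F (PadicAlgCl 3) n),
          r.toGaloisRep.IsIrreducible ∧ (r.restrictField E).toGaloisRep.IsIrreducible ∧
        ∃ (ι : PadicAlgCl 3 ≃+* ℂ) (hcpt : isCompact_glFiniteIntegralLevel n E)
          (PiE : CuspidalAutomorphicRepData n E hcpt),
          PiE.1.IsRegularAlgebraic ∧ HarrisLanTaylorThorne2016.IsCompatible PiE.1 ι (r.restrictField E) ∧
        ∃ (φ : F →+* ℝ) (c : absoluteGaloisGroup F), IsComplexConjugation φ c ∧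
          Matrix.trace ((r c : GL (Fin n) (PadicAlgCl 3)) : Matrix (Fin n) (Fin n) (PadicAlgCl 3)) ≠ 1 ∧
          Matrix.trace ((r c : GL (Fin n) (PadicAlgCl 3)) : Matrix (Fin n) (Fin n) (PadicAlgCl 3)) ≠ -1 := by
  sorry

/-- **stub 4 — quadratic (CM) descent of automorphy for Galois representations (Arthur–Clozel).**
Let `F` be totally real, `E/F` a totally complex quadratic extension, `r : Γ_F → GL_n(ℚ̄₃)` continuous
with `r|Γ_E` irreducible, and `Π` a regular algebraic cuspidal automorphic representation of `GL_n(𝔸_E)`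
HLTT-compatible with `r|Γ_E` through `ι`.  Then some regular algebraic cuspidal `π` of `GL_n(𝔸_F)` is
HLTT-compatible with `r` itself.  Proof sketch: for `σ ∈ Gal(E/F)`, `Π^σ` is compatible with
`(r|Γ_E)^σ ≅ r|Γ_E`, so `Π^σ ≅ Π` by strong multiplicity one; by Arthur–Clozel (cyclic base change of
prime degree, Thm. III.4.2) a `σ`-stable cuspidal `Π` is the base change of a cuspidal `π₀` of
`GL_n(𝔸_F)`, regular algebraic by the archimedean dictionary (tree:
`BaseChangeArchimedeanDescent.isRegularAlgebraic_descent` under `ArthurClozel1989_strongLifting_archimedean`);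
`r_{3,ι}(π₀)` exists (`F` totally real: Harris–Lan–Taylor–Thorne / Scholze, tree
`HarrisLanTaylorThorne2016.theoremA_existence`) and agrees with `r` on `Γ_E` (Chebotarev,
Brauer–Nesbitt, local base change at unramified places), so `r ≅ r_{3,ι}(π₀) ⊗ η^i` with `η` the
quadratic character of `E/F` (the two extensions of the irreducible `r|Γ_E`), and `π = π₀ ⊗ (η^i ∘ Art)`
works (`IsCompatible` is insensitive to the frame, `isCompatible_conj_iff`).  Calegari: "since `ρ` and
`ρ_h` extend to the totally real subfield `E⁺`, so does `ϱ`, and hence (by [AC]) `ϱ` comes from a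
RAESDC representation for `GL(9)/E⁺`".  Why it might fail: only bookkeeping (normalisations of `rec`,
the twist `η`); `n = 0` is excluded by the irreducibility hypothesis (the zero space is not simple).
Size L as a formalisation (citation-grade modulo [AC] and HLTT).
[cite: ArthurClozel1989, Thm. III.4.2 and Thm. III.5.1] [cite: Calegari2011, §4] [cite: HarrisLanTaylorThorneRMS2016, Thm. A] -/
theorem stub_quadraticDescent :
    ∀ (F : Type) [Field F] [NumberField F], IsTotallyReal F →
      ∀ (E : Type) [Field E] [NumberField E] [Algebra F E] [Algebra.IsQuadraticExtension F E],
        IsTotallyComplex E →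
      ∀ (n : ℕ) (r : FramedGaloisRep F (PadicAlgCl 3) n),
        (r.restrictField E).toGaloisRep.IsIrreducible →
      ∀ (ι : PadicAlgCl 3 ≃+* ℂ) (hcpt : isCompact_glFiniteIntegralLevel n E)
        (PiE : CuspidalAutomorphicRepData n E hcpt),
        PiE.1.IsRegularAlgebraic → HarrisLanTaylorThorne2016.IsCompatible PiE.1 ι (r.restrictField E) →
      ∃ (hcptF : isCompact_glFiniteIntegralLevel n F) (π : CuspidalAutomorphicRepData n F hcptF),
        π.1.IsRegularAlgebraic ∧ HarrisLanTaylorThorne2016.IsCompatible π.1 ι r := by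
  sorry

/-- **stub 5 — the sign of complex conjugation in odd rank (Taylor 2012 Prop. 1; Caraiani–Le Hung
2016 Thm. 1.1), at `l = 3`.**  For `F` totally real, `n` odd, `π` regular algebraic cuspidal on
`GL_n(𝔸_F)`, `r : Γ_F → GL_n(ℚ̄₃)` irreducible and HLTT-compatible with `π` through `ι`, and `c` a
complex conjugation: `tr r(c) = 1` or `tr r(c) = −1`.  This is VERBATIM the tree's
`Taylor2012_prop1_of_caraianiLeHung2016` at `p = 3` without its named-fact antecedent
`(h : CaraianiLeHung2016_thm_1_1)` — closable in one line from that fact (printed as conditional on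
Arthur's endoscopic classification), or by vendoring Taylor's unconditional Prop. 1 (essentially
self-dual case, which Calegari's `ϱ` is).  Why it might fail: it does not, short of an error in
[Taylor2012]/[CaraianiLehung2016]; stated as a stub because the crux carries no fact antecedents.
Size S (conditional) / citation-grade.
[cite: Taylor2012, Prop. 1 (p. 406) and Prop. 1.2] [cite: CaraianiLehung2016, Thm 1.1] -/
theorem stub_signOddRank :
    ∀ (F : Type) [Field F] [NumberField F], IsTotallyReal F → ∀ (n : ℕ), Odd n →
      ∀ (hcpt : isCompact_glFiniteIntegralLevel n F) (π : CuspidalAutomorphicRepData n F hcpt),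
        π.1.IsRegularAlgebraic →
      ∀ (ι : PadicAlgCl 3 ≃+* ℂ) (r : FramedGaloisRep F (PadicAlgCl 3) n),
        r.toGaloisRep.IsIrreducible → HarrisLanTaylorThorne2016.IsCompatible π.1 ι r →
      ∀ (φ : F →+* ℝ) (c : absoluteGaloisGroup F), IsComplexConjugation φ c →
        Matrix.trace ((r c : GL (Fin n) (PadicAlgCl 3)) : Matrix (Fin n) (Fin n) (PadicAlgCl 3)) = 1 ∨
          Matrix.trace ((r c : GL (Fin n) (PadicAlgCl 3)) : Matrix (Fin n) (Fin n) (PadicAlgCl 3)) = -1 := by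
  sorry

/-! ## The stub statements as named `Prop`s (literally their types) — the registrar's by-name hypotheses -/

namespace _Goal

/-- The statement of `stub_evenCyclotomicRestriction`, as a named `Prop` (literally its type). -/
def stub_evenCyclotomicRestriction : Prop :=
  type_of% @Summit.Langlands.Langlands.Cruxes.ThreeAdicAdequateImages.Birth.stub_evenCyclotomicRestriction

/-- The statement of `stub_symSqCyclotomicAdequate`, as a named `Prop` (literally its type). -/
def stub_symSqCyclotomicAdequate : Prop :=
  type_of% @Summit.Langlands.Langlands.Cruxes.ThreeAdicAdequateImages.Birth.stub_symSqCyclotomicAdequate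

/-- The statement of `stub_cmNinefoldShadow`, as a named `Prop` (literally its type). -/
def stub_cmNinefoldShadow : Prop :=
  type_of% @Summit.Langlands.Langlands.Cruxes.ThreeAdicAdequateImages.Birth.stub_cmNinefoldShadow

/-- The statement of `stub_quadraticDescent`, as a named `Prop` (literally its type). -/
def stub_quadraticDescent : Prop :=
  type_of% @Summit.Langlands.Langlands.Cruxes.ThreeAdicAdequateImages.Birth.stub_quadraticDescent

/-- The statement of `stub_signOddRank`, as a named `Prop` (literally its type). -/
def stub_signOddRank : Prop :=
  type_of% @Summit.Langlands.Langlands.Cruxes.ThreeAdicAdequateImages.Birth.stub_signOddRank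

end _Goal

/-- Read-back: the five stubs prove their named statements (definitionally their own types). -/
theorem goals_hold :
    _Goal.stub_evenCyclotomicRestriction ∧ _Goal.stub_symSqCyclotomicAdequate ∧
      _Goal.stub_cmNinefoldShadow ∧ _Goal.stub_quadraticDescent ∧ _Goal.stub_signOddRank :=
  ⟨stub_evenCyclotomicRestriction, stub_symSqCyclotomicAdequate, stub_cmNinefoldShadow,
    stub_quadraticDescent, stub_signOddRank⟩

/-- **`ThreeAdicAdequateImages` from its five stubs** — kernel-checked composition (no sorry).
Given the crux data `ρ` (even, a.e. unramified, de Rham regular at `3`, residually absolutely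
irreducible, non-dihedral, full projective image of order `∉ {12, 360}`): stub 1 (evenness) identifies
the projective image of `ρ̄|Γ_{ℚ(ζ₃)}` with the full one, so its order is `∉ {12, 360}` too; stub 2
gives the extended adequacy of `Sym² ρ̄(Γ_{ℚ(ζ₃)})`; stub 3 produces the automorphic shadow
`(F, E, n odd, r, ι, Π, c)` over the CM field `E` with `tr r(c) ∉ {±1}`; stub 4 descends `Π` to a
regular algebraic cuspidal `π` of `GL_n(𝔸_F)` compatible with `r`; stub 5 gives `tr r(c) = ±1`:
contradiction.  [cite: Calegari2011, §4] [cite: Taylor2012, Prop. 1] -/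
theorem ThreeAdicAdequateImages_of
    (h₁ : _Goal.stub_evenCyclotomicRestriction) (h₂ : _Goal.stub_symSqCyclotomicAdequate)
    (h₃ : _Goal.stub_cmNinefoldShadow) (h₄ : _Goal.stub_quadraticDescent)
    (h₅ : _Goal.stub_signOddRank) :
    Summit.Langlands.Langlands.Theses.EvenVoidBelowEight.ThreeAdicAdequateImages := by
  -- the stub statements, as the Π-types they literally are
  have HE : type_of% @stub_evenCyclotomicRestriction := h₁
  have HA : type_of% @stub_symSqCyclotomicAdequate := h₂
  have HS : type_of% @stub_cmNinefoldShadow := h₃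
  have HD : type_of% @stub_quadraticDescent := h₄
  have HT : type_of% @stub_signOddRank := h₅
  clear h₁ h₂ h₃ h₄ h₅
  intro ρ hev hur hdR hirr hdih himg
  -- stub 1: the projective image does not shrink on Γ_(ℚ(ζ₃))
  have hK := HE ρ hev
  have himgK : ¬ (Nat.card (projectiveImage (ρ.residualRep.comp
        (modPCyclotomicCharacterZMod ℚ 3).ker.subtype)) = 12 ∨
      Nat.card (projectiveImage (ρ.residualRep.comp
        (modPCyclotomicCharacterZMod ℚ 3).ker.subtype)) = 360) := by
    rw [hK]
    exact himg
  -- stub 2: adequacy of Sym² ρ̄(Γ_(ℚ(ζ₃)))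
  have hadq := HA ρ hirr hdih himgK
  -- stub 3: the automorphic shadow over a CM field, with the even sign
  obtain ⟨F, _, _, hF, E, _, _, _, hquad, hcm, n, hn, r, hrirr, hrirrE, ι, hcptE, PiE, hPreg, hPcomp,
    φ, c, hc, h1, h2⟩ := HS ρ hev hur hdR hirr hdih hadq
  -- stub 4: descent to the totally real field
  obtain ⟨hcptF, π, hπreg, hπcomp⟩ := HD F hF E hcm n r hrirrE ι hcptE PiE hPreg hPcomp
  -- stub 5: the sign of complex conjugation
  rcases HT F hF n hn hcptF π hπreg ι r hrirr hπcomp φ c hc with h | h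
  · exact h1 h
  · exact h2 h

/-- By-name sanity check (an `example`, not a declaration): the five stubs feed the composition as
they stand — `ThreeAdicAdequateImages` modulo exactly the five stubs (the only sorries of the file). -/
example : Summit.Langlands.Langlands.Theses.EvenVoidBelowEight.ThreeAdicAdequateImages :=
  ThreeAdicAdequateImages_of stub_evenCyclotomicRestriction stub_symSqCyclotomicAdequate
    stub_cmNinefoldShadow stub_quadraticDescent stub_signOddRank

end Summit.Langlands.Langlands.Cruxes.ThreeAdicAdequateImages.Birth

end
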